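import Mathlib
import Summits.Ventures.DiscreteObjects.Mahler.SubLehmerDegreeSixteen
import Summits.Ventures.DiscreteObjects.Mahler.CensusKernelDeg16Final

/-!
# Lehmer's conjecture for every integer polynomial of degree ≤ 17, in the kernel (venture `DiscreteObjects`, target L)

Cell `pub-namedobj`, seat `pub-namedobj-mahler-g13` (prepared for a successor). Framing: lottery ticket; floor = certified bounds/negative
ranges.

The degree-16 kernel census row `degreeCensus_sixteen` (16 cores; census search with Fejér–Riesz cuts,
`CensusKernelDeg16A … Final`) added to `SubLehmerDegreeSixteen`:
* `minimalMeasure_degree_sixteen` — an irreducible `P` of degree `16` with `M(P) > 1` has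
  `M(P) ≥ M(mrwMinimalPoly 16)` (MRW Table 1, `D = 16`, now a theorem for all integer polynomials of that degree);
  `minimalMeasureByDegree_le_sixteen` — the instances `D ≤ 16` of the Literature named fact `MinimalMeasureByDegree`;
* `lehmer_le_of_irreducible_of_natDegree_le_seventeen`, `lehmer_le_of_natDegree_le_seventeen` — every `P ∈ ℤ[X]` of
  degree `≤ 17` with `M(P) > 1` has `M(P) ≥ M(ℓ)`;
* `eighteen_le_natDegree_of_subLehmer` — `1 < M(P) < M(ℓ)` forces `deg P ≥ 18`; rungs `N ≤ 17` of the cell's sub-Lehmer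
  ladder and every `HeightCell h s d` with `d ≤ 17`, unconditionally;
* `kernelCensus_le_seventeen` — the census rows at `13/10` for every degree `1 … 17`.
CONTROL rows (published complete lists reach degree 44); kernel theorems with the standard axioms.
-/

namespace Summit.Ventures.DiscreteObjects.Mahler

open Polynomial Literature.NumberTheory.MahlerMeasure

/-- **Degree 16 (MRW Table 1, D = 16):** an irreducible `P` of degree `16` with `M(P) > 1` has `M(P) ≥ M(mrwMinimalPoly 16)`. -/
theorem minimalMeasure_degree_sixteen {P : ℤ[X]} (hirr : Irreducible P) (hdeg : P.natDegree = 16)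
    (h1 : 1 < intMahlerMeasure P) : intMahlerMeasure (mrwMinimalPoly 16) ≤ intMahlerMeasure P := by
  by_cases h : intMahlerMeasure P < 13 / 10
  · obtain ⟨l, hl, hform⟩ := degreeCensus_sixteen P hdeg hirr h1 h
    rw [intMahlerMeasure_of_census_form hform]
    exact coresDeg16_min l hl
  · push Not at h
    have h16 : intMahlerMeasure (mrwMinimalPoly 16) ≤ intMahlerMeasure (ofCoeffs c16_01) :=
      coresDeg16_min c16_01 (by simp [coresDeg16])
    exact le_trans h16 (le_trans (le_of_lt (coresDeg16_measure_bounds c16_01 (by simp [coresDeg16])).2) h)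

/-- An irreducible `P` of degree `16` with `M(P) > 1` has `M(P) > 1.1883 > M(ℓ)`. -/
theorem lehmer_lt_of_irreducible_degree_sixteen {P : ℤ[X]} (hirr : Irreducible P) (hdeg : P.natDegree = 16)
    (h1 : 1 < intMahlerMeasure P) : intMahlerMeasure lehmerPoly < intMahlerMeasure P := by
  have hL : intMahlerMeasure lehmerPoly < 11883 / 10 ^ 4 := lt_trans lehmer_measure_upper_bound (by norm_num)
  by_cases h : intMahlerMeasure P < 13 / 10
  · obtain ⟨l, hl, hform⟩ := degreeCensus_sixteen P hdeg hirr h1 h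
    rw [intMahlerMeasure_of_census_form hform]
    have hne : l ≠ c10_01 := by
      rintro rfl
      simp [coresDeg16, c10_01, c16_01, c16_02, c16_03, c16_04, c16_05, c16_06, c16_07, c16_08, c16_09, c16_10,
        c16_11, c16_12, c16_13, c16_14, c16_15, c16_16] at hl
    exact lt_trans hL (census_le18_gap l (by simp [hl]) hne)
  · push Not at h
    exact lt_of_lt_of_le (lt_trans hL (by norm_num)) h

/-- **Irreducible polynomials of degree `≤ 17` satisfy Lehmer's bound.** -/
theorem lehmer_le_of_irreducible_of_natDegree_le_seventeen {P : ℤ[X]} (hirr : Irreducible P)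
    (hdeg : P.natDegree ≤ 17) (h1 : 1 < intMahlerMeasure P) :
    intMahlerMeasure lehmerPoly ≤ intMahlerMeasure P := by
  by_cases h13 : P.natDegree ≤ 15
  · exact lehmer_le_of_irreducible_of_natDegree_le_fifteen hirr h13 h1
  by_cases hB : 13 / 10 ≤ intMahlerMeasure P
  · exact le_trans (le_of_lt (lt_trans lehmer_measure_upper_bound (by norm_num))) hB
  push Not at h13 hB
  have hθ : intMahlerMeasure P < smythTheta := lt_trans hB (lt_trans (by norm_num) smythTheta_gt)
  obtain ⟨-, ⟨j, hj⟩, -⟩ := reciprocal_of_measure_lt_smythTheta hirr h1 hθ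
  have hd : P.natDegree = 16 := by omega
  exact le_of_lt (lehmer_lt_of_irreducible_degree_sixteen hirr hd h1)

/-- **Lehmer's conjecture holds for every integer polynomial of degree `≤ 17`:** `M(P) > 1 ⇒ M(P) ≥ M(ℓ)`. -/
theorem lehmer_le_of_natDegree_le_seventeen {p : ℤ[X]} (hdeg : p.natDegree ≤ 17) (h1 : 1 < intMahlerMeasure p) :
    intMahlerMeasure lehmerPoly ≤ intMahlerMeasure p := by
  classical
  have hp : p ≠ 0 := by
    intro h
    rw [h] at h1
    unfold intMahlerMeasure at h1
    rw [Polynomial.map_zero, mahlerMeasure_zero] at h1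
    linarith
  obtain ⟨u, hu⟩ := UniqueFactorizationMonoid.factors_prod hp
  obtain ⟨c, hc, hcu⟩ := Polynomial.isUnit_iff.mp u.isUnit
  set F := UniqueFactorizationMonoid.factors p with hF
  have hFirr : ∀ f ∈ F, Irreducible f := fun f hf => UniqueFactorizationMonoid.irreducible_of_factor f hf
  have hMu : intMahlerMeasure (↑u : ℤ[X]) = 1 := by
    rw [← hcu, intMahlerMeasure_C]
    rcases Int.isUnit_iff.mp hc with h | h <;> simp [h]
  have hMp : intMahlerMeasure p = (F.map intMahlerMeasure).prod := by
    rw [← hu, intMahlerMeasure_mul, hMu, mul_one, intMahlerMeasure_multiset_prod]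
  have hdvd : ∀ f ∈ F, f ∣ p := fun f hf => (Multiset.dvd_prod hf).trans ⟨↑u, hu.symm⟩
  have hge1 : ∀ x ∈ F.map intMahlerMeasure, 1 ≤ x := by
    intro x hx
    obtain ⟨f, hf, rfl⟩ := Multiset.mem_map.mp hx
    exact one_le_intMahlerMeasure (hFirr f hf).ne_zero
  have hprod_ge : ∀ x ∈ F.map intMahlerMeasure, x ≤ (F.map intMahlerMeasure).prod := by
    intro x hx
    obtain ⟨T, hT⟩ := Multiset.exists_cons_of_mem hx
    rw [hT, Multiset.prod_cons]
    have hT1 : 1 ≤ T.prod :=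
      Multiset.one_le_prod (fun y hy => hge1 y (by rw [hT]; exact Multiset.mem_cons_of_mem hy))
    have hx0 : 0 ≤ x := le_trans zero_le_one (hge1 x hx)
    nlinarith
  by_contra hlt
  push Not at hlt
  have hall : ∀ x ∈ F.map intMahlerMeasure, x = 1 := by
    intro x hx
    obtain ⟨f, hf, rfl⟩ := Multiset.mem_map.mp hx
    by_contra hne
    have hgt : 1 < intMahlerMeasure f := lt_of_le_of_ne (hge1 _ hx) (Ne.symm hne)
    have hfdeg : f.natDegree ≤ 17 := (natDegree_le_of_dvd (hdvd f hf) hp).trans hdeg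
    have h2 := lehmer_le_of_irreducible_of_natDegree_le_seventeen (hFirr f hf) hfdeg hgt
    have h3 := hprod_ge _ hx
    rw [← hMp] at h3
    linarith
  have : (F.map intMahlerMeasure).prod = 1 := Multiset.prod_eq_one hall
  rw [← hMp] at this
  linarith

/-- **A sub-Lehmer polynomial has degree at least `18`.** -/
theorem eighteen_le_natDegree_of_subLehmer {P : ℤ[X]} (hP : SubLehmer P) : 18 ≤ P.natDegree := by
  by_contra h
  push Not at h
  have := lehmer_le_of_natDegree_le_seventeen (p := P) (by omega) hP.1
  exact absurd hP.2 (not_lt.mpr this)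

/-- Census rows in the engines' format, degrees `≤ 17`, below Lehmer's measure: nothing. -/
theorem heightBoundedCensus_subLehmer_of_le_seventeen {n h : ℕ} (hn : n ≤ 17) :
    HeightBoundedCensus n h (intMahlerMeasure lehmerPoly) [] := by
  refine ⟨fun p hdeg _ h1 h2 => ?_, fun l hl => by simp at hl⟩
  exfalso
  have := lehmer_le_of_natDegree_le_seventeen (p := p) (by omega) h1
  linarith

/-- **Rungs `N ≤ 17` of the sub-Lehmer ladder, unconditionally, at every height bound `h`.** -/
theorem heightSubLehmerEmptyUpTo_of_le_seventeen (h : ℕ) {N : ℕ} (hN : N ≤ 17) : HeightSubLehmerEmptyUpTo h N := by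
  intro P hdeg _ hP
  have := eighteen_le_natDegree_of_subLehmer hP
  omega

/-- Height-1 rungs `N ≤ 17`, unconditionally. -/
theorem height1SubLehmerEmptyUpTo_of_le_seventeen {N : ℕ} (hN : N ≤ 17) : Height1SubLehmerEmptyUpTo N :=
  (heightSubLehmerEmptyUpTo_one_iff N).mp (heightSubLehmerEmptyUpTo_of_le_seventeen 1 hN)

/-- Every cell `HeightCell h s d` with core degree `d ≤ 17` holds unconditionally. -/
theorem heightCell_of_le_seventeen (h : ℕ) (s : Multiset ℕ) {d : ℕ} (hd : d ≤ 17) : HeightCell h s d := by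
  intro Q hdeg _ _ _ _ _ hQ
  have := eighteen_le_natDegree_of_subLehmer hQ
  omega

/-- **`MinimalMeasureByDegree` for `D ≤ 16` (proved):** for every even `8 ≤ D ≤ 16`, an irreducible integer polynomial
of degree `D` with `M > 1` (primitive or not) has `M ≥ M(mrwMinimalPoly D)` — the `D = 8, …, 16` rows of MRW's
Theorem 1.1 / Table 1 in the Literature file's own terms. -/
theorem minimalMeasureByDegree_le_sixteen :
    ∀ D : ℕ, Even D → 8 ≤ D → D ≤ 16 →
      ∀ P : ℤ[X], Irreducible P → P.natDegree = D → 1 < (P.map (Int.castRingHom ℂ)).mahlerMeasure →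
        (∀ k : ℕ, 2 ≤ k → ∀ Q : ℤ[X], P ≠ expand ℤ k Q) →
          ((mrwMinimalPoly D).map (Int.castRingHom ℂ)).mahlerMeasure ≤ (P.map (Int.castRingHom ℂ)).mahlerMeasure := by
  intro D hD h8 h16 P hirr hdeg h1 hprim
  by_cases h14 : D ≤ 14
  · exact minimalMeasureByDegree_le_fourteen D hD h8 h14 P hirr hdeg h1 hprim
  · have hD16 : D = 16 := by
      obtain ⟨k, rfl⟩ := hD; omega
    subst hD16
    exact minimalMeasure_degree_sixteen hirr hdeg h1

/-- **The kernel census of small Mahler measures, degrees `1 … 17`, bound `13/10`:** the only irreducible integer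
polynomials of degree `n ∈ [1, 17]` with `1 < M < 1.3` are, up to `±x`, the listed cores of degrees `8` (one), `10` (seven),
`12` (five), `14` (eleven) and `16` (sixteen listed); every other degree `≤ 17` has none. -/
theorem kernelCensus_le_seventeen :
    DegreeCensus 8 (13 / 10) coresDeg8 ∧ DegreeCensus 10 (13 / 10) coresDeg10 ∧ DegreeCensus 12 (13 / 10) coresDeg12 ∧
      DegreeCensus 14 (13 / 10) coresDeg14 ∧ DegreeCensus 16 (13 / 10) coresDeg16 ∧
      ∀ n : ℕ, 1 ≤ n → n ≤ 17 → n ≠ 8 → n ≠ 10 → n ≠ 12 → n ≠ 14 → n ≠ 16 → DegreeCensus n (13 / 10) [] := by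
  refine ⟨degreeCensus_eight, degreeCensus_ten, degreeCensus_twelve, degreeCensus_fourteen, degreeCensus_sixteen, ?_⟩
  intro n hn1 hn15 h8 h10 h12 h14 h16
  have hθ : (13 : ℝ) / 10 ≤ smythTheta := le_of_lt (lt_trans (by norm_num) smythTheta_gt)
  rcases Nat.even_or_odd n with he | ho
  · have hφ : (13 : ℝ) / 10 ≤ (1 + Real.sqrt 5) / 2 := by
      have : (2 : ℝ) < Real.sqrt 5 := by
        rw [show (2 : ℝ) = Real.sqrt (2 ^ 2) by rw [Real.sqrt_sq (by norm_num)]]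
        exact Real.sqrt_lt_sqrt (by norm_num) (by norm_num)
      linarith
    obtain ⟨k, rfl⟩ := he
    rcases (by omega : k = 1 ∨ k = 2 ∨ k = 3) with rfl | rfl | rfl
    · exact degreeCensus_two_empty hφ
    · exact degreeCensus_mono (by norm_num) degreeCensus_four
    · exact degreeCensus_six
  · exact degreeCensus_odd_smythTheta ho hθ

end Summit.Ventures.DiscreteObjects.Mahler
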